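import Mathlib
import Summits.MatrixMultiplication.MatrixMultiplication.Theses.SemilatticeSTPP
import Summits.MatrixMultiplication.MatrixMultiplication.Theses.GroupTheoreticSTPP
import Literature.Computability.AlgebraicComplexity.GroupTheoreticMatMul

/-!
# Line `registered` of crux `SemilatticeSTPP.Thesis` (stmt-MatrixMultiplication-5969):
# the abelian lift `X_C ⇒ X_M` — every STPP family in a finite abelian group is a monoid-TPP family

The thesis `X_M` of route `SemilatticeSTPP` (`Theses.SemilatticeSTPP.Thesis`) asks, for every `ε > 0`, for a finite
commutative monoid `M` with every element regular (`x * y * x = x`) and a MONOID-TPP family (iff-form, indexed exactly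
like `matMulDirectSum`) with `|M| < Σᵢ (aᵢ bᵢ cᵢ)^((2+ε)/3)`.  The thesis `X_C` of route `GroupTheoreticSTPP`
(`Theses.GroupTheoreticSTPP.CThesis`) asks for the same with an STPP family `(Aᵢ, Bᵢ, Cᵢ)_{i<N}` of finsets in a finite
ADDITIVE abelian group `H` (Cohn–Kleinberg–Szegedy–Umans 2005, Def. 5.1, additive form; the tree predicate
`Literature.Computability.AlgebraicComplexity.IsSTPP`).  This file is the routine embedding:

* `thesisBodyAt_of_isSTPP` — an STPP family in `H` is a monoid-TPP family of the same shapes `aᵢ = |Aᵢ|`, `bᵢ = |Bᵢ|`,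
  `cᵢ = |Cᵢ|` in the host `M := Multiplicative H` (a finite abelian group, so every element is regular with `y := x⁻¹`):
  enumerate `Aᵢ, Bᵢ, Cᵢ` by `Finset.equivFin` and put `α ⟨i,(s,t)⟩ := S − T`, `β ⟨i,(t,u)⟩ := T − U`,
  `γ ⟨i,(s,u)⟩ := S − U` (written multiplicatively).  Then `α x · β y = γ z` reads `(S' − T) + (T' − U) = S − U'`, i.e.
  `(S' − S) + (T' − T) + (U' − U) = 0` — literally the binder pattern of `IsSTPP` — so the indices agree and the enumerated
  elements coincide, whence (injectivity of the enumeration) the coordinates coincide.  Hence the `∃`-body of `Thesis`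
  holds at every exponent `τ` at which the STPP family beats `|H|`.
* `thesis_of_cThesis` — the corollary `X_C ⇒ X_M` (take `τ := (2+ε)/3`).

Mathlib + the three tree files above; sorry-free; no new definitions (all data are existential witnesses).
-/

set_option linter.dupNamespace false
-- (single-conjunct summit: the namespace repeats `MatrixMultiplication`)

namespace Summit.MatrixMultiplication.MatrixMultiplication.Theorems.SemilatticeSTPPThesis

open Literature.Computability.AlgebraicComplexity

/-- **Abelian lift, body form.**  Every STPP family `(A i, B i, C i)_{i<N}` in a finite additive abelian group `H`
(CKSU 2005 Def. 5.1 / BCCGNSU 2017 Def. 2.2, tree predicate `IsSTPP`) yields a monoid-TPP family (iff-form) of shapes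
`(|A i|, |B i|, |C i|)` in the finite commutative (regular) monoid `Multiplicative H`; consequently the `∃`-body of
`SemilatticeSTPP.Thesis` holds at every exponent `τ` with `|H| < Σᵢ (|A i| |B i| |C i|)^τ`.
[cite: CohnKleinbergSzegedyUmans2005, Def. 5.1] -/
theorem thesisBodyAt_of_isSTPP :
    ∀ (H : Type) [AddCommGroup H] [Fintype H] (N : ℕ) (A B C : Fin N → Finset H),
      Literature.Computability.AlgebraicComplexity.IsSTPP A B C → ∀ τ : ℝ,
      (Fintype.card H : ℝ) < ∑ i, (((A i).card * (B i).card * (C i).card : ℕ) : ℝ) ^ τ →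
      ∃ (M : Type) (_ : CommMonoid M) (_ : Fintype M), (∀ x : M, ∃ y : M, x * y * x = x) ∧
        ∃ (p : ℕ) (a b c : Fin p → ℕ) (α : (Σ i, Fin (a i) × Fin (b i)) → M)
          (β : (Σ i, Fin (b i) × Fin (c i)) → M) (γ : (Σ i, Fin (a i) × Fin (c i)) → M),
          (∀ x y z, α x * β y = γ z ↔
            (z.1 = x.1 ∧ x.1 = y.1 ∧ (z.2.1 : ℕ) = x.2.1 ∧ (x.2.2 : ℕ) = y.2.1 ∧ (z.2.2 : ℕ) = y.2.2)) ∧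
          (Fintype.card M : ℝ) < ∑ i, ((a i * b i * c i : ℕ) : ℝ) ^ τ := by
  intro H _ _ N A B C hS τ hlt
  -- injective enumerations of the finsets `A i`, `B i`, `C i` by `Fin (card)`
  obtain ⟨eA, hAmem, hAinj⟩ : ∃ e : ∀ i, Fin (A i).card → H,
      (∀ i s, e i s ∈ A i) ∧ ∀ i, Function.Injective (e i) :=
    ⟨fun i s => ((A i).equivFin.symm s : H), fun i s => Finset.coe_mem _,
      fun i s s' h => (A i).equivFin.symm.injective (Subtype.ext h)⟩
  obtain ⟨eB, hBmem, hBinj⟩ : ∃ e : ∀ i, Fin (B i).card → H,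
      (∀ i t, e i t ∈ B i) ∧ ∀ i, Function.Injective (e i) :=
    ⟨fun i t => ((B i).equivFin.symm t : H), fun i t => Finset.coe_mem _,
      fun i t t' h => (B i).equivFin.symm.injective (Subtype.ext h)⟩
  obtain ⟨eC, hCmem, hCinj⟩ : ∃ e : ∀ i, Fin (C i).card → H,
      (∀ i u, e i u ∈ C i) ∧ ∀ i, Function.Injective (e i) :=
    ⟨fun i u => ((C i).equivFin.symm u : H), fun i u => Finset.coe_mem _,
      fun i u u' h => (C i).equivFin.symm.injective (Subtype.ext h)⟩
  refine ⟨Multiplicative H, inferInstance, inferInstance, fun x => ⟨x⁻¹, inv_mul_cancel_right x x⟩, N,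
    fun i => (A i).card, fun i => (B i).card, fun i => (C i).card,
    fun x => Multiplicative.ofAdd (eA x.1 x.2.1 - eB x.1 x.2.2),
    fun y => Multiplicative.ofAdd (eB y.1 y.2.1 - eC y.1 y.2.2),
    fun z => Multiplicative.ofAdd (eA z.1 z.2.1 - eC z.1 z.2.2), ?_, ?_⟩
  · rintro ⟨i, s, t⟩ ⟨j, t', u⟩ ⟨k, s', u'⟩
    dsimp only
    constructor
    · intro h
      rw [← ofAdd_add] at h
      have h' : (eA i s - eB i t) + (eB j t' - eC j u) = eA k s' - eC k u' := Multiplicative.ofAdd.injective h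
      have key : (eA i s - eA k s') + (eB j t' - eB i t) + (eC k u' - eC j u) = 0 := by
        rw [← sub_eq_zero.mpr h']; abel
      obtain ⟨rfl, rfl, hs, ht, hu⟩ := hS i j k _ (hAmem k s') _ (hAmem i s) _ (hBmem i t) _ (hBmem j t')
        _ (hCmem j u) _ (hCmem k u') key
      obtain rfl := hAinj i hs
      obtain rfl := hBinj i ht
      obtain rfl := hCinj i hu
      exact ⟨rfl, rfl, rfl, rfl, rfl⟩
    · rintro ⟨h₁, h₂, h₃, h₄, h₅⟩
      subst h₁ h₂
      obtain rfl := Fin.ext h₃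
      obtain rfl := Fin.ext h₄
      obtain rfl := Fin.ext h₅
      rw [← ofAdd_add]
      congr 1
      abel
  · rw [Fintype.card_multiplicative]
    exact hlt

/-- **Abelian lift `X_C ⇒ X_M`.**  The thesis of route `GroupTheoreticSTPP` (STPP families in finite abelian groups beating
`|H|` at exponent `(2+ε)/3` for every `ε > 0`) implies the thesis of route `SemilatticeSTPP` (monoid-TPP families in
finite commutative regular monoids beating `|M|` at the same exponent): host `Multiplicative H`, by
`thesisBodyAt_of_isSTPP`. [cite: CohnKleinbergSzegedyUmans2005, Def. 5.1] -/
theorem thesis_of_cThesis :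
    Summit.MatrixMultiplication.MatrixMultiplication.Theses.GroupTheoreticSTPP.CThesis →
      Summit.MatrixMultiplication.MatrixMultiplication.Theses.SemilatticeSTPP.Thesis := by
  intro hC ε hε
  obtain ⟨H, _, _, N, A, B, C, hS, hlt⟩ := hC ε hε
  exact thesisBodyAt_of_isSTPP H N A B C ((isSTPP_iff A B C).2 hS) _ hlt

end Summit.MatrixMultiplication.MatrixMultiplication.Theorems.SemilatticeSTPPThesis
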